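import Mathlib
import Summits.Ventures.PercRepro2.HCov
import Summits.Ventures.PercRepro2.HCovSwap
import Summits.Ventures.PercRepro2.ContractDefs
import Summits.Ventures.PercRepro2.RECMReduction

/-!
# The root-edge reduction with a universal constant: (c-RECM) (blind cell PercRepro2, p1 g10;
lead g19 ASSIGNMENTS v12.08 after NEG-97 / NEG-98)

NEG-98 (engine D154, twinned by the lead and by p1's own enumerator): the weighted (RECM)
`Gc(G) ≥ p_e · Gc(G/e)` at an unmarked-`y` root edge is FALSE from 8 vertices / 9 edges, so the
hypothesis `RECM_all` of `RECMReduction.HCov_all_of_RECM_all` fails. The induction there only uses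
`Gc(G) ≥ c · p_e · Gc(G/e)` for SOME constant `c ≥ 0` — the same for every graph. This file threads
that constant through:

* **`cRECMAt c`**: `c · p_e · Gc(G/e) ≤ Gc(G)` at the root edge `e = {a₁, y}` (`RECMAt` is `c = 1`);
* **`cRECM_all c`**: (c-RECM) at every unmarked-`y` root edge of every finite graph (row (c-RECM),
  the weighted shadow of (c-CW) `N_{(k′,j)} ≥ c · N_{(k′,3)}`, `j = 1, 2`);
* **`HCov_all_of_cRECM_all`**: `0 ≤ c → cRECM_all c → HCovR_all → HCov_all` — the reduction of
  `RECMReduction` with the constant threaded through (any `c > 0` closes the induction; `c = 0` is the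
  tautology); **`HCov_all_of_exists_cRECM`**: the `∃ c > 0` form.
-/

namespace Summit.Ventures.PercRepro2

open CovForm Contract

namespace RECM

section Defs

variable {V : Type*} {E : Type*} [Fintype E] [DecidableEq E] [DecidableEq V] {R : Type*}
  [Field R] [LinearOrder R]

/-- **(c-RECM) at the root edge `e = {a₁, y}`**: `c · p_e · Gc(G/e) ≤ Gc(G)` (`RECMAt` is the case
`c = 1`). -/
def cRECMAt (c : R) (p : E → R) (ends : E → Sym2 V) (o a₁ a₂ a₃ b : V) (e : E) (y : V) : Prop :=
  c * (p e * Gc p (contractRootEdge ends a₁ y) o a₁ a₂ a₃ b) ≤ Gc p ends o a₁ a₂ a₃ b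

/-- `RECMAt` is `cRECMAt 1`. -/
lemma RECMAt_iff_cRECMAt_one (p : E → R) (ends : E → Sym2 V) (o a₁ a₂ a₃ b : V) (e : E) (y : V) :
    RECMAt p ends o a₁ a₂ a₃ b e y ↔ cRECMAt 1 p ends o a₁ a₂ a₃ b e y := by
  unfold RECMAt cRECMAt
  rw [one_mul]

end Defs

section Closure

variable (R : Type*) [Field R] [LinearOrder R] [IsStrictOrderedRing R]

/-- **Row (c-RECM)**: (c-RECM) with the constant `c` at every root edge `e = {a₁, y}` with `y`
unmarked, on every finite graph with distinct marks and admissible weights. -/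
def cRECM_all (c : R) : Prop :=
  ∀ (V E : Type) [Fintype V] [DecidableEq V] [Fintype E] [DecidableEq E]
    (ends : E → Sym2 V) (p : E → R), IsProbVec p →
    ∀ o a₁ a₂ a₃ b : V, a₁ ≠ a₂ → a₁ ≠ a₃ → a₂ ≠ a₃ → o ≠ a₁ → o ≠ a₂ → o ≠ a₃ → o ≠ b →
      b ≠ a₁ → b ≠ a₂ → b ≠ a₃ → ∀ (y : V) (e : E), Unmarked o a₁ a₂ a₃ b y → ends e = s(a₁, y) →
        cRECMAt c p ends o a₁ a₂ a₃ b e y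

omit [IsStrictOrderedRing R] in
/-- `RECM_all` is `cRECM_all 1`. -/
lemma RECM_all_iff_cRECM_all_one : RECM_all R ↔ cRECM_all R 1 := by
  constructor
  · intro h V E _ _ _ _ ends p hp o a₁ a₂ a₃ b h12 h13 h23 ho1 ho2 ho3 hob hb1 hb2 hb3 y e hy he
    exact (RECMAt_iff_cRECMAt_one p ends o a₁ a₂ a₃ b e y).mp
      (h V E ends p hp o a₁ a₂ a₃ b h12 h13 h23 ho1 ho2 ho3 hob hb1 hb2 hb3 y e hy he)
  · intro h V E _ _ _ _ ends p hp o a₁ a₂ a₃ b h12 h13 h23 ho1 ho2 ho3 hob hb1 hb2 hb3 y e hy he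
    exact (RECMAt_iff_cRECMAt_one p ends o a₁ a₂ a₃ b e y).mpr
      (h V E ends p hp o a₁ a₂ a₃ b h12 h13 h23 ho1 ho2 ho3 hob hb1 hb2 hb3 y e hy he)

end Closure

section Main

variable {R : Type*} [Field R] [LinearOrder R] [IsStrictOrderedRing R]

/-- **The reduction with the constant threaded through**, by strong induction on the number of
non-loop edges: (HCOV) for every graph on the types `V, E` from (c-RECM) at unmarked-`y` root edges
(`0 ≤ c`) and (HCOV) on class R. -/
theorem HCov_of_cRECM_of_base {V E : Type} [Fintype V] [DecidableEq V] [Fintype E] [DecidableEq E]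
    {c : R} (hc : 0 ≤ c) (hR : cRECM_all R c) (hB : HCovR_all R) (n : ℕ) :
    ∀ (ends : E → Sym2 V), nonLoopCard ends = n → ∀ (p : E → R), IsProbVec p →
      ∀ o a₁ a₂ a₃ b : V, a₁ ≠ a₂ → a₁ ≠ a₃ → a₂ ≠ a₃ → o ≠ a₁ → o ≠ a₂ → o ≠ a₃ → o ≠ b →
        b ≠ a₁ → b ≠ a₂ → b ≠ a₃ → HCov p ends o a₁ a₂ a₃ b := by
  induction n using Nat.strong_induction_on with
  | _ n ih =>
  intro ends hn p hp o a₁ a₂ a₃ b h12 h13 h23 ho1 ho2 ho3 hob hb1 hb2 hb3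
  by_cases h1 : ∃ (e : E) (y : V), Unmarked o a₁ a₂ a₃ b y ∧ ends e = s(a₁, y)
  · -- a root edge at `a₁` reaches an unmarked vertex: contract it
    obtain ⟨e, y, hy, he⟩ := h1
    have hrecm := hR V E ends p hp o a₁ a₂ a₃ b h12 h13 h23 ho1 ho2 ho3 hob hb1 hb2 hb3 y e hy he
    have hlt : nonLoopCard (contractRootEdge ends a₁ y) < n :=
      hn ▸ nonLoopCard_contract_lt ends hy.2.1.symm he
    have hIH := ih _ hlt (contractRootEdge ends a₁ y) rfl p hp o a₁ a₂ a₃ b h12 h13 h23 ho1 ho2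
      ho3 hob hb1 hb2 hb3
    unfold HCov at hIH ⊢
    unfold cRECMAt at hrecm
    exact le_trans (mul_nonneg hc (mul_nonneg (hp.nonneg e) hIH)) hrecm
  · by_cases h2 : ∃ (e : E) (y : V), Unmarked o a₁ a₂ a₃ b y ∧ ends e = s(a₂, y)
    · -- a root edge at `a₂` reaches an unmarked vertex: swap the roots and contract it
      obtain ⟨e, y, hy, he⟩ := h2
      have hy' : Unmarked o a₂ a₁ a₃ b y := ⟨hy.1, hy.2.2.1, hy.2.1, hy.2.2.2.1, hy.2.2.2.2⟩
      have hrecm := hR V E ends p hp o a₂ a₁ a₃ b h12.symm h23 h13 ho2 ho1 ho3 hob hb2 hb1 hb3 y e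
        hy' he
      have hlt : nonLoopCard (contractRootEdge ends a₂ y) < n :=
        hn ▸ nonLoopCard_contract_lt ends hy.2.2.1.symm he
      have hIH := ih _ hlt (contractRootEdge ends a₂ y) rfl p hp o a₁ a₂ a₃ b h12 h13 h23 ho1 ho2
        ho3 hob hb1 hb2 hb3
      unfold HCov at hIH ⊢
      unfold cRECMAt at hrecm
      rw [Gc_swap p (contractRootEdge ends a₂ y) o a₁ a₂ a₃ b, Gc_swap p ends o a₁ a₂ a₃ b] at hrecm
      exact le_trans (mul_nonneg hc (mul_nonneg (hp.nonneg e) hIH)) hrecm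
    · -- both roots are adjacent only to marks: class R
      apply hB V E ends p hp o a₁ a₂ a₃ b h12 h13 h23 ho1 ho2 ho3 hob hb1 hb2 hb3
      intro f hroot z hz
      rcases hroot with hf | hf
      · obtain ⟨y, hy⟩ := Sym2.mem_iff_exists.mp hf
        rw [hy] at hz
        rcases Sym2.mem_iff.mp hz with hz1 | hz2
        · rw [hz1]
          simp
        · rw [hz2]
          by_contra hzm
          push Not at hzm
          exact h1 ⟨f, y, hzm, hy⟩
      · obtain ⟨y, hy⟩ := Sym2.mem_iff_exists.mp hf
        rw [hy] at hz
        rcases Sym2.mem_iff.mp hz with hz1 | hz2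
        · rw [hz1]
          simp
        · rw [hz2]
          by_contra hzm
          push Not at hzm
          exact h2 ⟨f, y, hzm, hy⟩

/-- **THE ROOT-EDGE REDUCTION WITH A UNIVERSAL CONSTANT**: `0 ≤ c → cRECM_all c → HCovR_all → HCov_all`
— (HCOV) for every finite weighted graph from (c-RECM) at unmarked-`y` root edges (one constant for
all graphs) together with (HCOV) on class R. -/
theorem HCov_all_of_cRECM_all {c : R} (hc : 0 ≤ c) (hR : cRECM_all R c) (hB : HCovR_all R) :
    HCov_all R := by
  intro V E _ _ _ _ ends p hp o a₁ a₂ a₃ b h12 h13 h23 ho1 ho2 ho3 hob hb1 hb2 hb3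
  exact HCov_of_cRECM_of_base hc hR hB _ ends rfl p hp o a₁ a₂ a₃ b h12 h13 h23 ho1 ho2 ho3 hob
    hb1 hb2 hb3

/-- The `∃ c > 0` form of the reduction (lead g19, ASSIGNMENTS v12.08):
`(∃ c > 0, cRECM_all c) → HCovR_all → HCov_all`. -/
theorem HCov_all_of_exists_cRECM (hR : ∃ c : R, 0 < c ∧ cRECM_all R c) (hB : HCovR_all R) :
    HCov_all R := by
  obtain ⟨c, hc, hR⟩ := hR
  exact HCov_all_of_cRECM_all hc.le hR hB

end Main

end RECM

end Summit.Ventures.PercRepro2
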